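import Literature.MathematicalPhysics.QuantumFieldTheory.Balaban1983to89.B9Eq3126HTransposeCoords
import Literature.MathematicalPhysics.QuantumFieldTheory.Balaban1983to89.B9SupLettersFromClassLetters

/-!
# `Balaban1983to89.B9Eq3126HTransposeScaledMajorant` — [B9] p. 422, the transpose family `(C ∘ Q) ∘ G_D` of (3.126)'s `H`, WITH THE (3.42)₁ SCALE `(Lʲη)²` OF
# `G_D` CARRIED TO THE COARSE END (the scaled sequel of `B9Eq3126HTransposeCoords` §2)

T. Bałaban, *Propagators for lattice gauge theories in a background field*, Commun. Math. Phys. **99** (1985) 389–434 [`Balaban1985BackgroundPropagators`, "B9"]: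
(3.126) p. 420 (`H = GQ*(QGQ*)⁻¹`), (3.130) p. 421, (3.42) p. 397 (*«|(G′(U)λ)(x)| ≤ B₀(Lʲη)²e^{−δ₀d(y,y′)}|λ| for x ∈ Δ(y)»* — the entry of `G` carries `(Lʲη)²`
at the TARGET block), (3.132)–(3.133) p. 422 (*«|(QGQ*)⁻¹(y, y′)| ≦ O(1)(Lʲη)⁻²(L^{j′}η)^{−d}e^{−δ₁d(y,y′)}»*, *«|H_{μν}(x, y′)| … ≦ O(1)… (L^{j′}η)^{−d}e^{…}»* — the
`(Lʲη)²` of `G` cancels the `(Lʲη)⁻²` of `(QGQ*)⁻¹`), p. 398 (remark after (3.47): *«Using Lemma 2.1 in [4] we may replace the factor (Lʲη)^α by (Lʲη)^β(L^{j′}η)^γ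
with β + γ = α»*); [4] = T. Bałaban, *Propagators and renormalization transformations for lattice gauge theories. II*, Commun. Math. Phys. **96** (1984) 223–250
[`Balaban1984PropagatorsII`]: (2.51)–(2.56) pp. 232–233, Lemma 2.1 (2.60)–(2.61) p. 234.

statement-level companion of published sources with citation tags; every declaration here is a theorem; nothing here is a claim about the Yang–Mills mass gap

WHY THIS FILE (cell `pub-ymgap`, node N06, bundle F7 rows 20–21, seat dag-n06-l g33; programme P-D2).  Seat n06-w8's `B9Eq3126HTransposeCoords.hasMajorantHom_CQG_of_letters`
composes the counting-transpose `(C ∘ Q) ∘ G_D` of `H`'s coordinate model from a FLAT sup letter of `G_D` (`r_G·e^{−(1−α)δ d}`) and the weighted (3.132) letter of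
`C` (`r_C·W_C(a)·e^{−δ d}`).  At the N06 record the letter of `G_D` that Thm 3.12 produces is print's (3.42)₁ — `r_G·(Lʲη)_a²·e^{−ρ d(a, y′)}`, the square scale sitting
at the TARGET block `a` (dag-n06-l `…N06GDSupLegAtPinsPUW.gdsup_of_pins` ∕ `B9Thm312WholeEntry0Regular`); flattening it by `(Lʲη)_a ≤ 1` loses exactly the factor that
print uses to cancel `(QGQ*)⁻¹`'s `(Lʲη)⁻²` in (3.133), and the loss would reappear as a non-inhabitable weight on the [5] (149) letter of the (3.137) road.  THIS FILE
keeps the scale: two convolutions ([4] (2.55)–(2.56)) in which `(Lʲη)_y²` is moved to the output block by the p. 398 transfer (`B9SupLettersFromClassLetters.len_sq_ratio_transfer`,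
cost `L₀²·e^{α₁δ₁ d}`) and the remaining exponential is summed by [4] (2.61) (`B11SectG.RowSum`).
* §1 ★ `sum_exp_mul_lensq_le` — the kernel convolution with a transferred square scale (pure bookkeeping over any [B9] geometry with the member facts):
  `Σ_y e^{−κ₁ d(c,y)}·((Lʲη)_y²·e^{−κ₂ d(y,b)}) ≤ L₀²·c_R·(Lʲη)_c²·e^{−m d(c,b)}` for `0 ≤ m ≤ κ₂`, `m + σ + α₁δ₁ ≤ κ₁`.
* §2 ★★ `hasMajorantHom_CQG_of_letters_sq` — `(C ∘ Q) ∘ G_D : (fine blocks) → (coarse blocks)` has the [4]-(2.51) majorant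
  `(r_C·(e^{δ_Q(ℓ+4)}·r_G·L₀²·c_R)·L₀²·c_R)·(W_C(c)·(Lʲη)_c²)·e^{−ρ_T d(c, y′)}` from `G_D`'s SCALED letter `r_G·(Lʲη)_a²·e^{−ρ_G d}`, `C`'s weighted letter
  `r_C·W_C(a)·e^{−δ_C d}` and n06-w5's letter of `Q` at the rate `δ_Q := ρ_G + σ + α₁δ₁` (Q is local, any rate), for `0 ≤ ρ_T ≤ ρ_G`, `ρ_T + σ + α₁δ₁ ≤ δ_C` — i.e. the
  transpose letter's coarse weight is `W_T = W_C·(Lʲη)²` (at the record `W_C = n·(Lʲη)⁻²`, so `W_T = n`, the fine-site count of the coarse cell: print's `H* = n⁻¹·H†`).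
HONEST SCOPE.  Finite sums and exponentials, [4] (2.51)∕(2.55)∕(2.60)∕(2.61) bookkeeping with explicit constants; the three letters are HYPOTHESES (nothing of [B9]
asserted); count-neutral; N06 NOT discharged; one finite lattice at a time — nothing continuum ∕ OS ∕ mass gap ∕ Clay.  NEW file; n06-w8's `B9Eq3126HTransposeCoords`
untouched and used BY NAME (`hasMajorantHom_QcoKH` through it).
-/

noncomputable section

namespace Literature.MathematicalPhysics.QuantumFieldTheory.Balaban1983to89.B9Eq3126HTransposeScaledMajorant

open Node00 (CfgY FBondY IBondY parBY)
open Node00.OpsYSectDCoords (QcoKH)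
open B6KLevelCensusIndexV1 (KIdx)
open B6RandomWalk (HasMajorant)
open B6RandomWalkHom (HasMajorantHom hasMajorantHom_comp hasMajorantHom_mono hasMajorantHom_iff)
open B9Thm34Ext (toB6)
open B11SectG (RowSum)
open B9Thm312Whole (GeoOK)
open B9RWSums343to347Whole (Facts347)
open B9SupLettersFromClassLetters (len_sq_ratio_transfer)
open B9CoReadingCoords (XBK blkBK)
open B9CoReadingCoordsH (XHK blkHK)
open B9CoReadingCoordsTranspose (TrIdx trBasis)
open B9GeoNormsKLevelV1 (geo9K)
open B9QLettersAtPins (hasMajorantHom_QcoKH)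
open B6Ineq2142KLevelV1 (β)
open B6GlobalChartV1 (blkV1)
open B6Geom246MultiLevelTorus (geomT)
open scoped Matrix.Norms.L2Operator

/-! ## §1 The kernel convolution with a transferred square scale -/

section Kernel

variable {g : B9.Geometry} [Fintype g.Site] {R₀ : ℝ} {H₀ : Prop}

/-- ★ **CONVOLUTION WITH A TRANSFERRED SQUARE SCALE** ([4] (2.55)–(2.56) with the p. 398 transfer): for `0 ≤ m ≤ κ₂` and `m + σ + α₁δ₁ ≤ κ₁`,
`Σ_y e^{−κ₁ d(c,y)}·((Lʲη)_y²·e^{−κ₂ d(y,b)}) ≤ L₀²·c_R·(Lʲη)_c²·e^{−m d(c,b)}` — the square scale of the summed block `y` is transferred to `c` (`len_sq_ratio_transfer`,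
cost `L₀²e^{α₁δ₁ d(c,y)}`), `m` of the decay is kept along `d(c,b) ≤ d(c,y) + d(y,b)` and the remaining `e^{−σ d(c,y)}` is summed by (2.61).
[cite: Balaban1984PropagatorsII, (2.55)–(2.56) p.233, Lemma 2.1 (2.60)–(2.61) p.234; Balaban1985BackgroundPropagators, p.398 (remark after (3.47))] -/
theorem sum_exp_mul_lensq_le (hG : GeoOK g) {dF : ℕ} {δ₁ α₁ L₀ : ℝ} (hF : Facts347 g R₀ H₀ dF δ₁ α₁ L₀) {σ cR : ℝ} (hrow : RowSum (toB6 g R₀ H₀) σ cR)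
    {κ₁ κ₂ m : ℝ} (hm : 0 ≤ m) (hmκ₂ : m ≤ κ₂) (hκ₁ : m + σ + α₁ * δ₁ ≤ κ₁) (c b : g.Site) :
    ∑ y : g.Site, Real.exp (-(κ₁ * g.dist c y)) * (g.len y ^ 2 * Real.exp (-(κ₂ * g.dist y b)))
      ≤ L₀ ^ 2 * cR * g.len c ^ 2 * Real.exp (-(m * g.dist c b)) := by
  have hc := hG.lenpos c
  -- pointwise: e^{−κ₁ d(c,y)}·(Lʲη)_y²·e^{−κ₂ d(y,b)} ≤ (L₀²·(Lʲη)_c²·e^{−m d(c,b)})·e^{−σ d(c,y)}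
  have hpt : ∀ y : g.Site, Real.exp (-(κ₁ * g.dist c y)) * (g.len y ^ 2 * Real.exp (-(κ₂ * g.dist y b))) ≤
      (L₀ ^ 2 * g.len c ^ 2 * Real.exp (-(m * g.dist c b))) * Real.exp (-(σ * g.dist c y)) := by
    intro y
    have hy := hG.lenpos y
    have hdcy : 0 ≤ g.dist c y := hG.dnn c y
    have hdyb : 0 ≤ g.dist y b := hG.dnn y b
    have htri : g.dist c b ≤ g.dist c y + g.dist y b := hG.tri c y b
    -- the transfer `(Lʲη)_y² ≤ L₀²·e^{α₁δ₁ d(y,c)}·(Lʲη)_c²`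
    have htr := len_sq_ratio_transfer hG hF y c
    have hyc : g.dist y c = g.dist c y := hG.symm y c
    rw [hyc] at htr
    have hE : 0 < Real.exp (-(α₁ * δ₁ * g.dist c y)) := Real.exp_pos _
    have hlen : g.len y ^ 2 ≤ L₀ ^ 2 * Real.exp (α₁ * δ₁ * g.dist c y) * g.len c ^ 2 := by
      have h1 : g.len y ^ 2 = (Real.exp (-(α₁ * δ₁ * g.dist c y)) * (g.len y ^ 2 * (g.len c ^ 2)⁻¹)) *
          (Real.exp (α₁ * δ₁ * g.dist c y) * g.len c ^ 2) := by
        rw [Real.exp_neg]; field_simp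
      rw [h1]
      calc Real.exp (-(α₁ * δ₁ * g.dist c y)) * (g.len y ^ 2 * (g.len c ^ 2)⁻¹) * (Real.exp (α₁ * δ₁ * g.dist c y) * g.len c ^ 2)
          ≤ L₀ ^ 2 * (Real.exp (α₁ * δ₁ * g.dist c y) * g.len c ^ 2) :=
            mul_le_mul_of_nonneg_right htr (mul_nonneg (Real.exp_nonneg _) (pow_nonneg hc.le 2))
        _ = L₀ ^ 2 * Real.exp (α₁ * δ₁ * g.dist c y) * g.len c ^ 2 := by ring
    -- the exponents: −κ₁D₁ + α₁δ₁D₁ − κ₂D₂ ≤ −m d(c,b) − σD₁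
    have hexp : Real.exp (-(κ₁ * g.dist c y)) * Real.exp (α₁ * δ₁ * g.dist c y) * Real.exp (-(κ₂ * g.dist y b)) ≤
        Real.exp (-(m * g.dist c b)) * Real.exp (-(σ * g.dist c y)) := by
      rw [← Real.exp_add, ← Real.exp_add, ← Real.exp_add]
      apply Real.exp_le_exp.mpr
      have h1 : m * g.dist c b ≤ m * g.dist c y + m * g.dist y b := by nlinarith
      have h2 : 0 ≤ (κ₁ - α₁ * δ₁ - m - σ) * g.dist c y := mul_nonneg (by linarith) hdcy
      have h3 : 0 ≤ (κ₂ - m) * g.dist y b := mul_nonneg (by linarith) hdyb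
      nlinarith
    calc Real.exp (-(κ₁ * g.dist c y)) * (g.len y ^ 2 * Real.exp (-(κ₂ * g.dist y b)))
        ≤ Real.exp (-(κ₁ * g.dist c y)) * ((L₀ ^ 2 * Real.exp (α₁ * δ₁ * g.dist c y) * g.len c ^ 2) * Real.exp (-(κ₂ * g.dist y b))) :=
          mul_le_mul_of_nonneg_left (mul_le_mul_of_nonneg_right hlen (Real.exp_nonneg _)) (Real.exp_nonneg _)
      _ = (L₀ ^ 2 * g.len c ^ 2) * (Real.exp (-(κ₁ * g.dist c y)) * Real.exp (α₁ * δ₁ * g.dist c y) * Real.exp (-(κ₂ * g.dist y b))) := by ring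
      _ ≤ (L₀ ^ 2 * g.len c ^ 2) * (Real.exp (-(m * g.dist c b)) * Real.exp (-(σ * g.dist c y))) :=
          mul_le_mul_of_nonneg_left hexp (mul_nonneg (sq_nonneg _) (pow_nonneg hc.le 2))
      _ = (L₀ ^ 2 * g.len c ^ 2 * Real.exp (-(m * g.dist c b))) * Real.exp (-(σ * g.dist c y)) := by ring
  calc ∑ y : g.Site, Real.exp (-(κ₁ * g.dist c y)) * (g.len y ^ 2 * Real.exp (-(κ₂ * g.dist y b)))
      ≤ ∑ y : g.Site, (L₀ ^ 2 * g.len c ^ 2 * Real.exp (-(m * g.dist c b))) * Real.exp (-(σ * g.dist c y)) := Finset.sum_le_sum fun y _ => hpt y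
    _ = (L₀ ^ 2 * g.len c ^ 2 * Real.exp (-(m * g.dist c b))) * ∑ y : g.Site, Real.exp (-(σ * g.dist c y)) := by rw [Finset.mul_sum]
    _ ≤ (L₀ ^ 2 * g.len c ^ 2 * Real.exp (-(m * g.dist c b))) * cR :=
        mul_le_mul_of_nonneg_left (hrow c) (mul_nonneg (mul_nonneg (sq_nonneg _) (pow_nonneg hc.le 2)) (Real.exp_nonneg _))
    _ = L₀ ^ 2 * cR * g.len c ^ 2 * Real.exp (-(m * g.dist c b)) := by ring

end Kernel

/-! ## §2 The transpose family with the scale of `G_D` carried to the coarse end -/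

section Majorant

variable {N : ℕ} {d ℓ : ℕ} {hd : 1 ≤ d + 1} {hL : Odd (ℓ + 1) ∧ 1 < ℓ + 1} {b₀ b₁ : ℝ}
variable (i : KIdx d ℓ hd hL b₀ b₁) (B : B9.Backgrounds) (cfg : B.Cfg → CfgY (Matrix (Fin N) (Fin N) ℂ) i)
variable {R₀ : ℝ} {H₀ : Prop}

/-- ★★ **THE TRANSPOSE COMPOSITE `(C ∘ Q) ∘ G_D` FROM THE SCALED LETTER OF `G_D`** (module docstring): from `G_D`'s (3.42)₁-shaped letter `r_G·(Lʲη)_a²·e^{−ρ_G d}`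
(scale at the TARGET block), `C`'s weighted sup letter `r_C·W_C(a)·e^{−δ_C d}` and `Q`'s letter at the rate `δ_Q := ρ_G + σ + α₁δ₁` (n06-w5, any rate: `Q` is local),
the composite has the [4]-(2.51) majorant `(r_C·(e^{δ_Q(ℓ+4)}·r_G·L₀²·c_R)·L₀²·c_R)·(W_C(c)·(Lʲη)_c²)·e^{−ρ_T d(c, y′)}` from the fine blocks `blkBK bI` to the coarse blocks `blkHK`,
for `0 ≤ ρ_T ≤ ρ_G`, `ρ_T + σ + α₁δ₁ ≤ δ_C` (member facts `Facts347` for the transfer, `RowSum` at `σ` for the two sums). [cite: Balaban1985BackgroundPropagators, (3.126) p.420, (3.130) p.421, (3.42) p.397, (3.132)–(3.133) p.422, (3.13)–(3.14) pp.392–393, p.398; Balaban1984PropagatorsII, (2.51)–(2.56) pp.232–233, Lemma 2.1 (2.60)–(2.61) p.234] -/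
theorem hasMajorantHom_CQG_of_letters_sq [Fintype (geo9K i).Site] {bI : FBondY i → IBondY i}
    (hβ1 : ∀ f : FBondY i, (geomT i.D).dist (β i.hN i.D i.hk (bI f)) (blkV1 i.hN i.D f) ≤ 1) (U₁ : B.Cfg)
    (hpar : ∀ s s', ‖(parBY i (cfg U₁) s s' : Matrix (Fin N) (Fin N) ℂ)‖ ≤ 1 ∧ ‖(((parBY i (cfg U₁) s s')⁻¹ : (Matrix (Fin N) (Fin N) ℂ)ˣ) : Matrix (Fin N) (Fin N) ℂ)‖ ≤ 1)
    (hGK : GeoOK (geo9K i)) {dF : ℕ} {δ₁ α₁ L₀ : ℝ} (hF : Facts347 (geo9K i) R₀ H₀ dF δ₁ α₁ L₀)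
    {σ cR : ℝ} (hrow : RowSum (toB6 (geo9K i) R₀ H₀) σ cR) (hcR : 0 ≤ cR) (hσ : 0 ≤ σ) (hαδ : 0 ≤ α₁ * δ₁)
    {ρG δC ρT rG rC : ℝ} {WC : (geo9K i).Site → ℝ} (hρT : 0 ≤ ρT) (hρTG : ρT ≤ ρG) (hρTC : ρT + σ + α₁ * δ₁ ≤ δC)
    (hrG : 0 ≤ rG) (hrC : 0 ≤ rC) (hWC : ∀ a, 0 ≤ WC a)
    {CC : (XHK (TrIdx N) i → ℝ) →ₗ[ℝ] (XHK (TrIdx N) i → ℝ)} {GG : (XBK (TrIdx N) i → ℝ) →ₗ[ℝ] (XBK (TrIdx N) i → ℝ)}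
    (hG : HasMajorant (g := toB6 (geo9K i) R₀ H₀) (blkBK i bI) GG (fun a b => rG * (geo9K i).len a ^ 2 * Real.exp (-(ρG * (geo9K i).dist a b))))
    (hC : HasMajorant (g := toB6 (geo9K i) R₀ H₀) (blkHK i) CC (fun a b => rC * WC a * Real.exp (-(δC * (geo9K i).dist a b)))) :
    HasMajorantHom (g := toB6 (geo9K i) R₀ H₀) (blkBK i bI) (blkHK i) ((CC ∘ₗ QcoKH i (trBasis N) B cfg (parBY i) U₁) ∘ₗ GG)
      (fun a b => (rC * (Real.exp ((ρG + σ + α₁ * δ₁) * ((ℓ : ℝ) + 4)) * rG * L₀ ^ 2 * cR) * L₀ ^ 2 * cR) * (WC a * (geo9K i).len a ^ 2) *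
        Real.exp (-(ρT * (geo9K i).dist a b))) := by
  have hρG : 0 ≤ ρG := hρT.trans hρTG
  have hδQ : 0 ≤ ρG + σ + α₁ * δ₁ := add_nonneg (add_nonneg hρG hσ) hαδ
  -- Q : fine → coarse at the rate δ_Q := ρ_G + σ + α₁δ₁ (n06-w5)
  have hQ := hasMajorantHom_QcoKH i (trBasis N) B cfg (parBY i) hβ1 (U₁ := U₁) hpar hδQ R₀ H₀
  -- (1) `Q ∘ G_D`: insert the partition on the fine blocks, transfer the square scale to the coarse block, sum by (2.61) — rate ρ_G kept
  have hK₂ : ∀ a b : (geo9K i).Site, 0 ≤ rG * (geo9K i).len a ^ 2 * Real.exp (-(ρG * (geo9K i).dist a b)) :=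
    fun a b => mul_nonneg (mul_nonneg hrG (pow_nonneg (hGK.lenpos a).le 2)) (Real.exp_nonneg _)
  have hQG₀ := hasMajorantHom_comp (g := toB6 (geo9K i) R₀ H₀) (blkBK i bI) (blkBK i bI) (blkHK i)
    (T₁ := QcoKH i (trBasis N) B cfg (parBY i) U₁) (T₂ := GG) hQ ((hasMajorantHom_iff _ _ _).2 hG) hK₂
  have hQG : HasMajorantHom (g := toB6 (geo9K i) R₀ H₀) (blkBK i bI) (blkHK i) (QcoKH i (trBasis N) B cfg (parBY i) U₁ ∘ₗ GG)
      (fun a b => (Real.exp ((ρG + σ + α₁ * δ₁) * ((ℓ : ℝ) + 4)) * rG * L₀ ^ 2 * cR) * (geo9K i).len a ^ 2 * Real.exp (-(ρG * (geo9K i).dist a b))) := by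
    refine hasMajorantHom_mono _ _ hQG₀ fun a b => ?_
    have hs := sum_exp_mul_lensq_le (g := geo9K i) hGK hF hrow (κ₁ := ρG + σ + α₁ * δ₁) (κ₂ := ρG) (m := ρG) hρG le_rfl le_rfl a b
    calc ∑ y : (toB6 (geo9K i) R₀ H₀).Site, Real.exp ((ρG + σ + α₁ * δ₁) * ((ℓ : ℝ) + 4)) * Real.exp (-((ρG + σ + α₁ * δ₁) * (geo9K i).dist a y)) *
          (rG * (geo9K i).len y ^ 2 * Real.exp (-(ρG * (geo9K i).dist y b)))
        = Real.exp ((ρG + σ + α₁ * δ₁) * ((ℓ : ℝ) + 4)) * rG *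
            ∑ y : (geo9K i).Site, Real.exp (-((ρG + σ + α₁ * δ₁) * (geo9K i).dist a y)) * ((geo9K i).len y ^ 2 * Real.exp (-(ρG * (geo9K i).dist y b))) := by
          rw [Finset.mul_sum]; refine Finset.sum_congr rfl fun y _ => ?_; ring
      _ ≤ Real.exp ((ρG + σ + α₁ * δ₁) * ((ℓ : ℝ) + 4)) * rG * (L₀ ^ 2 * cR * (geo9K i).len a ^ 2 * Real.exp (-(ρG * (geo9K i).dist a b))) :=
          mul_le_mul_of_nonneg_left hs (mul_nonneg (Real.exp_nonneg _) hrG)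
      _ = (Real.exp ((ρG + σ + α₁ * δ₁) * ((ℓ : ℝ) + 4)) * rG * L₀ ^ 2 * cR) * (geo9K i).len a ^ 2 * Real.exp (-(ρG * (geo9K i).dist a b)) := by ring
  -- (2) `C ∘ (Q ∘ G_D)`: the same move on the coarse blocks, at the target rate ρ_T
  have hKQG : ∀ a b : (geo9K i).Site, 0 ≤ (Real.exp ((ρG + σ + α₁ * δ₁) * ((ℓ : ℝ) + 4)) * rG * L₀ ^ 2 * cR) * (geo9K i).len a ^ 2 *
      Real.exp (-(ρG * (geo9K i).dist a b)) := fun a b =>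
    mul_nonneg (mul_nonneg (by positivity) (pow_nonneg (hGK.lenpos a).le 2)) (Real.exp_nonneg _)
  have hcomp := hasMajorantHom_comp (g := toB6 (geo9K i) R₀ H₀) (blkBK i bI) (blkHK i) (blkHK i) (T₁ := CC)
    (T₂ := QcoKH i (trBasis N) B cfg (parBY i) U₁ ∘ₗ GG) ((hasMajorantHom_iff _ _ _).2 hC) hQG hKQG
  rw [← LinearMap.comp_assoc] at hcomp
  refine hasMajorantHom_mono _ _ hcomp fun a b => ?_
  have hs := sum_exp_mul_lensq_le (g := geo9K i) hGK hF hrow (κ₁ := δC) (κ₂ := ρG) (m := ρT) hρT hρTG hρTC a b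
  set K₁ : ℝ := Real.exp ((ρG + σ + α₁ * δ₁) * ((ℓ : ℝ) + 4)) * rG * L₀ ^ 2 * cR with hK₁
  have hK₁0 : 0 ≤ K₁ := by positivity
  calc ∑ y : (toB6 (geo9K i) R₀ H₀).Site, rC * WC a * Real.exp (-(δC * (geo9K i).dist a y)) * (K₁ * (geo9K i).len y ^ 2 * Real.exp (-(ρG * (geo9K i).dist y b)))
      = rC * WC a * K₁ * ∑ y : (geo9K i).Site, Real.exp (-(δC * (geo9K i).dist a y)) * ((geo9K i).len y ^ 2 * Real.exp (-(ρG * (geo9K i).dist y b))) := by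
        rw [Finset.mul_sum]; refine Finset.sum_congr rfl fun y _ => ?_; ring
    _ ≤ rC * WC a * K₁ * (L₀ ^ 2 * cR * (geo9K i).len a ^ 2 * Real.exp (-(ρT * (geo9K i).dist a b))) :=
        mul_le_mul_of_nonneg_left hs (mul_nonneg (mul_nonneg hrC (hWC a)) hK₁0)
    _ = (rC * K₁ * L₀ ^ 2 * cR) * (WC a * (geo9K i).len a ^ 2) * Real.exp (-(ρT * (geo9K i).dist a b)) := by ring

end Majorant

end Literature.MathematicalPhysics.QuantumFieldTheory.Balaban1983to89.B9Eq3126HTransposeScaledMajorant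

end
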